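import Literature.Geometry.Lorentzian.FutureCompleteImageFutureSet
import Literature.Geometry.Lorentzian.CompleteDevelopmentMaximal
import Literature.Geometry.Lorentzian.CausalityClosure
import Literature.Geometry.Lorentzian.CausalityPushUp
import HarnessLib

/-!
# A timelike geodesically complete spacetime is inextendible: an isometric immersion from it into a
# connected spacetime is onto (Beem–Ehrlich 1981, Prop. 5.16 (3)); timelike complete developments
# are maximal

`CompleteIsometricImmersionOnto.lean` (O'Neill 1983, Cor. 7.29) needs geodesic completeness in ALL
directions; `FutureCompleteImageFutureSet.lean` shows that future (past) TIMELIKE completeness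
alone makes the image a future (past) set. This file combines the two one-sided statements:

* `LorentzianMetric.eq_univ_of_chronologicalFuture_subset_of_chronologicalPast_subset` — **in a
  connected time-oriented Lorentzian manifold without boundary, a nonempty open set which is both a
  future set and a past set is everything**: a frontier point `z` has a point `r ≫ z`
  (`mem_closure_chronologicalFuture_self`), the open set `I⁻(r) ∋ z` meets `W` in some `w`, so
  `r ∈ I⁺(w) ⊆ W` and then `z ∈ I⁻(r) ⊆ W`;
* `LorentzianMetric.surjective_of_isIsometricImmersion_of_timecones`,
  `…surjective_of_isTimelikeGeodesicallyComplete` — **a time-orientation preserving isometric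
  immersion between equidimensional spacetimes whose source has `exp` defined on the future and past
  timecones — in particular a TIMELIKE geodesically complete source — and whose target is connected
  is onto** (Beem–Ehrlich 1981, Prop. 5.16 (3): "timelike geodesically complete ⇒ inextendible",
  in the immersion form);
* `DataEmbedding.EmbedsInto.isIsometricTo_of_isTimelikeGeodesicallyComplete`,
  `VacuumCauchyDevelopment.IsMaximal.isIsometricTo_of_isTimelikeGeodesicallyComplete`,
  `VacuumCauchyDevelopment.isMaximal_of_isTimelikeGeodesicallyComplete_of_exists`,
  `VacuumCauchyDevelopment.isMaximal_of_isTimelikeGeodesicallyComplete[_of_mem_admissibleVacuumData]`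
  — the development corollaries of `CompleteDevelopmentMaximal.lean` with geodesic completeness
  weakened to TIMELIKE geodesic completeness: **a timelike geodesically complete vacuum Cauchy
  development is isometric to every maximal one, hence maximal as soon as a maximal development of
  its data exists** (e.g. given `choquetBruhat_geroch_exists_mghd_cauchy`).

Everything is proved; no definitions and no named facts are introduced.

## References

* J. K. Beem, P. E. Ehrlich, *Global Lorentzian Geometry*, Marcel Dekker 1981, Prop. 5.16 (3).
  Key `BeemEhrlich1981`.
* B. O'Neill, *Semi-Riemannian geometry with applications to relativity*, Academic Press 1983,
  Ch. 14, Lemma 14.3 and Lemma 14.6 (pp. 402–404); Ch. 5, Lemma 5.33. Key `ONeillSemiRiemannian1983`.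
* Y. Choquet-Bruhat, R. Geroch, Comm. Math. Phys. 14 (1969) 329–335, Thm. 3.
  Key `ChoquetBruhatGeroch1969CMP`.
-/

noncomputable section

open Bundle Set Filter Function TopologicalSpace
open scoped Manifold ContDiff Topology

namespace Literature.Geometry.Lorentzian

open Literature.Geometry.Riemannian

/-! ### A nonempty open future-and-past set is everything -/

section FuturePast

variable {E : Type*} [NormedAddCommGroup E] [NormedSpace ℝ E] {H : Type*} [TopologicalSpace H]
  {I : ModelWithCorners ℝ E H} {n : ℕ∞ω} {M : Type*} [TopologicalSpace M] [ChartedSpace H M]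
  [IsManifold I ∞ M] [BoundarylessManifold I M]

namespace LorentzianMetric

/-- **In a connected time-oriented Lorentzian manifold without boundary, a nonempty open set which
is both a future set and a past set is the whole manifold** (zig-zag connectedness: O'Neill 1983,
Ch. 14, Lemma 14.3 and Lemma 14.6 (2)). [cite: ONeillSemiRiemannian1983, Ch. 14, Lemma 14.3 and Lemma 14.6 (pp. 402–404)] -/
theorem eq_univ_of_chronologicalFuture_subset_of_chronologicalPast_subset [PreconnectedSpace M]
    (g : LorentzianMetric I n M) (τ : TimeOrientation g) {W : Set M} (hW : IsOpen W)
    (hne : W.Nonempty) (hfut : g.chronologicalFuture τ W ⊆ W)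
    (hpast : g.chronologicalPast τ W ⊆ W) : W = univ := by
  by_contra huniv
  have hncl : ¬ IsClosed W := fun hcl ↦ huniv (IsClopen.eq_univ ⟨hcl, hW⟩ hne)
  obtain ⟨z, hzcl, hzW⟩ : ∃ z, z ∈ closure W ∧ z ∉ W := by
    by_contra h
    push Not at h
    exact hncl (closure_subset_iff_isClosed.1 fun z hz ↦ h z hz)
  -- a point `r ≫ z`
  obtain ⟨r, hr⟩ : (g.chronologicalFuture τ {z}).Nonempty :=
    closure_nonempty_iff.1
      ⟨z, g.mem_closure_chronologicalFuture_self τ BoundarylessManifold.isInteriorPoint⟩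
  -- the open set `I⁻(r) ∋ z` meets `W`
  have hz : z ∈ g.chronologicalPast τ {r} := mem_chronologicalPast_of_mem_chronologicalFuture hr
  obtain ⟨w, hwP, hwW⟩ := mem_closure_iff_nhds.1 hzcl _
    ((isOpen_chronologicalPast_of_boundaryless g τ {r}).mem_nhds hz)
  -- `r ∈ I⁺(w) ⊆ W`, then `z ∈ I⁻(r) ⊆ W`
  have hrW : r ∈ W := hfut (chronologicalFuture_mono (singleton_subset_iff.2 hwW)
    (mem_chronologicalFuture_of_mem_chronologicalPast hwP))
  exact hzW (hpast (chronologicalFuture_mono (singleton_subset_iff.2 hrW) hz))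

end LorentzianMetric

end FuturePast

/-! ### Timelike complete ⇒ onto -/

section Core

variable {d : ℕ} {M : Type*} [TopologicalSpace M] [ChartedSpace (EuclideanSpace ℝ (Fin d)) M]
  [IsManifold (𝓡 d) ∞ M] [T2Space M]
  {N : Type*} [TopologicalSpace N] [ChartedSpace (EuclideanSpace ℝ (Fin d)) N]
  [IsManifold (𝓡 d) ∞ N] [T2Space N]

namespace LorentzianMetric

variable {gM : LorentzianMetric (𝓡 d) ∞ M} [gM.HasLeviCivita]
  [CovariantDerivative.ContMDiffCovariantDerivative gM.leviCivita 1]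
  [CovariantDerivative.ContMDiffCovariantDerivative gM.leviCivita (⊤ : ℕ∞)]
  {τM : TimeOrientation gM}
  {gN : LorentzianMetric (𝓡 d) ∞ N} [gN.HasLeviCivita]
  [CovariantDerivative.ContMDiffCovariantDerivative gN.leviCivita 1] {τN : TimeOrientation gN}
  {f : N → M}

/-- **An isometric immersion whose source has `exp` defined on the future and past timecones, into a
connected spacetime of the same dimension, is onto**: its image is open
(`IsIsometricImmersion.isOpenMap`), a future set and a past set
(`chronologicalFuture_range_subset_of_isIsometricImmersion` and its dual), hence everything.
Beem–Ehrlich 1981, Prop. 5.16 (3). [cite: BeemEhrlich1981, Prop. 5.16 (3)] -/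
theorem surjective_of_isIsometricImmersion_of_timecones [PreconnectedSpace M] [Nonempty N]
    (hf : gN.toPseudoRiemannianMetric.IsIsometricImmersion gM.toPseudoRiemannianMetric f)
    (hτ : τN.PreservesTimeOrientation f τM)
    (hfut : ∀ (y : N) (w : TangentSpace (𝓡 d) y), gN.IsTimelike w → τN.IsFutureDirected w →
      w ∈ expDomain gN.leviCivita y)
    (hpast : ∀ (y : N) (w : TangentSpace (𝓡 d) y), gN.IsTimelike w → τN.reverse.IsFutureDirected w →
      w ∈ expDomain gN.leviCivita y) :
    Surjective f := by
  have huniv := eq_univ_of_chronologicalFuture_subset_of_chronologicalPast_subset gM τM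
    (hf.isOpenMap rfl).isOpen_range (range_nonempty f)
    (chronologicalFuture_range_subset_of_isIsometricImmersion hf hτ hfut)
    (chronologicalPast_range_subset_of_isIsometricImmersion hf hτ hpast)
  exact range_eq_univ.1 huniv

/-- **Beem–Ehrlich 1981, Prop. 5.16 (3), immersion form: a time-orientation preserving isometric
immersion from a TIMELIKE geodesically complete spacetime into a connected spacetime of the same
dimension is onto** (timelike geodesically complete ⇒ inextendible). [cite: BeemEhrlich1981, Prop. 5.16 (3)] -/
theorem surjective_of_isTimelikeGeodesicallyComplete [PreconnectedSpace M] [Nonempty N]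
    [Fact (1 ≤ (∞ : ℕ∞ω))]
    (hf : gN.toPseudoRiemannianMetric.IsIsometricImmersion gM.toPseudoRiemannianMetric f)
    (hτ : τN.PreservesTimeOrientation f τM) (hcpl : gN.IsTimelikeGeodesicallyComplete) :
    Surjective f :=
  surjective_of_isIsometricImmersion_of_timecones hf hτ
    (fun y w hw _ ↦ mem_expDomain_of_isTimelikeGeodesicallyComplete hcpl y w hw)
    (fun y w hw _ ↦ mem_expDomain_of_isTimelikeGeodesicallyComplete hcpl y w hw)

end LorentzianMetric

end Core

/-! ### Developments: timelike complete ⇒ maximal -/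

section Developments

universe u

variable {n : ℕ} {X : Type u} [TopologicalSpace X] [ChartedSpace (EuclideanSpace ℝ (Fin n)) X]
  [IsManifold (𝓡 n) ∞ X] [ConnectedSpace X] {D : InitialDataSet (𝓡 n) X}

namespace DataEmbedding

/-- **An isometric immersion of a timelike geodesically complete data embedding into another one
(same data, preserving time orientation) is onto.** Beem–Ehrlich 1981, Prop. 5.16 (3), for the
connected target spacetime. [cite: BeemEhrlich1981, Prop. 5.16 (3)] -/
theorem surjective_of_isTimelikeGeodesicallyComplete {𝒮₁ 𝒮₂ : DataEmbedding D}
    {ψ : 𝒮₁.carrier → 𝒮₂.carrier}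
    (hψ : 𝒮₁.metric.IsIsometricImmersion 𝒮₂.metric.toPseudoRiemannianMetric ψ)
    (hτ : 𝒮₁.timeOrientation.PreservesTimeOrientation ψ 𝒮₂.timeOrientation)
    (hc : ∀ [𝒮₁.metric.toPseudoRiemannianMetric.HasLeviCivita],
      𝒮₁.metric.IsTimelikeGeodesicallyComplete) :
    Surjective ψ := by
  haveI := 𝒮₁.metric.toPseudoRiemannianMetric.hasLeviCivita
  haveI := 𝒮₂.metric.toPseudoRiemannianMetric.hasLeviCivita
  haveI : CovariantDerivative.ContMDiffCovariantDerivative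
      𝒮₁.metric.toPseudoRiemannianMetric.leviCivita 1 :=
    ⟨𝒮₁.metric.isLocallyContMDiff_leviCivita_holds 1 (by exact_mod_cast le_top) univ isOpen_univ⟩
  haveI : CovariantDerivative.ContMDiffCovariantDerivative
      𝒮₂.metric.toPseudoRiemannianMetric.leviCivita 1 :=
    ⟨𝒮₂.metric.isLocallyContMDiff_leviCivita_holds 1 (by exact_mod_cast le_top) univ isOpen_univ⟩
  haveI := Literature.Geometry.Riemannian.contMDiffCovariantDerivative_leviCivita_infty
    𝒮₂.metric.toPseudoRiemannianMetric le_rfl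
  haveI : Nonempty 𝒮₁.carrier := ⟨𝒮₁.embed (Classical.arbitrary X)⟩
  haveI : Fact (1 ≤ (∞ : ℕ∞ω)) := ⟨by exact_mod_cast (le_top : (1 : ℕ∞) ≤ ⊤)⟩
  exact LorentzianMetric.surjective_of_isTimelikeGeodesicallyComplete hψ hτ hc

/-- **An embedding of a timelike geodesically complete data embedding into another one (same data)
is an isometry of developments.** Beem–Ehrlich 1981, Prop. 5.16 (3); Choquet-Bruhat–Geroch 1969,
p. 334. [cite: BeemEhrlich1981, Prop. 5.16 (3)] -/
theorem EmbedsInto.isIsometricTo_of_isTimelikeGeodesicallyComplete {𝒮₁ 𝒮₂ : DataEmbedding D}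
    (h : 𝒮₁.EmbedsInto 𝒮₂)
    (hc : ∀ [𝒮₁.metric.toPseudoRiemannianMetric.HasLeviCivita],
      𝒮₁.metric.IsTimelikeGeodesicallyComplete) :
    𝒮₁.IsIsometricTo 𝒮₂ := by
  obtain ⟨ψ, -, hψo, hψi, hψτ, hψι⟩ := h
  have hbij : Bijective ψ :=
    ⟨hψo.injective, surjective_of_isTimelikeGeodesicallyComplete hψi hψτ hc⟩
  set Φ := (hψi.isLocalDiffeomorph rfl).diffeomorphOfBijective hbij with hΦ_def
  have hΦ : (Φ : 𝒮₁.carrier → 𝒮₂.carrier) = ψ := rfl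
  refine ⟨Φ, ?_, ?_, ?_⟩
  · intro y
    rw [hΦ]
    exact hψi.2 y
  · intro y
    rw [hΦ]
    exact hψτ y
  · rw [hΦ]
    exact hψι

end DataEmbedding

namespace VacuumCauchyDevelopment

/-- **Every maximal vacuum Cauchy development is isometric to any TIMELIKE geodesically complete
one** (unconditional). Choquet-Bruhat–Geroch 1969, Thm. 3; Beem–Ehrlich 1981, Prop. 5.16 (3).
[cite: ChoquetBruhatGeroch1969CMP, Thm. 3 (pp. 332–334)] -/
theorem IsMaximal.isIsometricTo_of_isTimelikeGeodesicallyComplete {𝒟₀ 𝒟 : VacuumCauchyDevelopment D}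
    (h₀ : 𝒟₀.IsMaximal)
    (hc : ∀ [𝒟.metric.toPseudoRiemannianMetric.HasLeviCivita],
      𝒟.metric.IsTimelikeGeodesicallyComplete) :
    𝒟.toCauchyDevelopment.IsIsometricTo 𝒟₀.toCauchyDevelopment :=
  DataEmbedding.EmbedsInto.isIsometricTo_of_isTimelikeGeodesicallyComplete (h₀ 𝒟) hc

/-- **A timelike geodesically complete vacuum Cauchy development is maximal as soon as some maximal
development of its data exists.** Choquet-Bruhat–Geroch 1969, Thm. 3; Beem–Ehrlich 1981,
Prop. 5.16 (3). [cite: ChoquetBruhatGeroch1969CMP, Thm. 3 (pp. 332–334)] -/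
theorem isMaximal_of_isTimelikeGeodesicallyComplete_of_exists {𝒟 : VacuumCauchyDevelopment D}
    (hc : ∀ [𝒟.metric.toPseudoRiemannianMetric.HasLeviCivita],
      𝒟.metric.IsTimelikeGeodesicallyComplete)
    (hex : ∃ 𝒟₀ : VacuumCauchyDevelopment D, 𝒟₀.IsMaximal) : 𝒟.IsMaximal := by
  obtain ⟨𝒟₀, h₀⟩ := hex
  exact h₀.of_isIsometricTo (h₀.isIsometricTo_of_isTimelikeGeodesicallyComplete hc).symm

/-- For a timelike geodesically complete development, `IsMaximal ↔ ∃ maximal development`.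
[cite: ChoquetBruhatGeroch1969CMP, Thm. 3 (pp. 332–334)] -/
theorem isMaximal_iff_exists_of_isTimelikeGeodesicallyComplete {𝒟 : VacuumCauchyDevelopment D}
    (hc : ∀ [𝒟.metric.toPseudoRiemannianMetric.HasLeviCivita],
      𝒟.metric.IsTimelikeGeodesicallyComplete) :
    𝒟.IsMaximal ↔ ∃ 𝒟₀ : VacuumCauchyDevelopment D, 𝒟₀.IsMaximal :=
  ⟨fun h ↦ ⟨𝒟, h⟩, isMaximal_of_isTimelikeGeodesicallyComplete_of_exists hc⟩

end VacuumCauchyDevelopment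

end Developments

section CBG

variable {X : Type} [TopologicalSpace X] [ChartedSpace E3 X] [IsManifold (𝓡 3) ∞ X]
  [T2Space X] [SecondCountableTopology X] [ConnectedSpace X] {D : InitialDataSet (𝓡 3) X}

/-- **A timelike geodesically complete vacuum Cauchy development of constraint-solving data is
maximal**, given the Choquet-Bruhat–Geroch existence theorem. [cite: ChoquetBruhatGeroch1969CMP, Thm. 3 (pp. 332–334)] -/
theorem VacuumCauchyDevelopment.isMaximal_of_isTimelikeGeodesicallyComplete
    (hcbg : choquetBruhat_geroch_exists_mghd_cauchy) [D.metric.HasLeviCivita]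
    (hD : D.IsVacuumConstraintSolution) {𝒟 : VacuumCauchyDevelopment D}
    (hc : ∀ [𝒟.metric.toPseudoRiemannianMetric.HasLeviCivita],
      𝒟.metric.IsTimelikeGeodesicallyComplete) : 𝒟.IsMaximal :=
  VacuumCauchyDevelopment.isMaximal_of_isTimelikeGeodesicallyComplete_of_exists hc
    (hcbg.exists_isMaximal D hD)

/-- **A timelike geodesically complete vacuum Cauchy development of an admissible datum is
maximal**, given `choquetBruhat_geroch_exists_mghd_cauchy`. [cite: ChoquetBruhatGeroch1969CMP, Thm. 3 (pp. 332–334)] -/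
theorem VacuumCauchyDevelopment.isMaximal_of_isTimelikeGeodesicallyComplete_of_mem_admissibleVacuumData
    (hcbg : choquetBruhat_geroch_exists_mghd_cauchy) (hD : D ∈ admissibleVacuumData X)
    {𝒟 : VacuumCauchyDevelopment D}
    (hc : ∀ [𝒟.metric.toPseudoRiemannianMetric.HasLeviCivita],
      𝒟.metric.IsTimelikeGeodesicallyComplete) : 𝒟.IsMaximal :=
  VacuumCauchyDevelopment.isMaximal_of_isTimelikeGeodesicallyComplete_of_exists hc
    (hcbg.exists_isMaximal_of_mem_admissibleVacuumData hD)

end CBG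

end Literature.Geometry.Lorentzian

end
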